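import Literature.NumberTheory.Automorphic.Sweep1SymmetricPowerAdelicProofs
import Literature.NumberTheory.Automorphic.GLnCuspidalSpectrumDiscreteProofs
import HarnessLib

/-!
# Gelbart's dictionary `Gelbart1975_exists_isAutomorphicRepOf`: reduction to the automorphic measure

Sibling proof file (theorems only, no `sorry`, no named fact) of
`Literature.NumberTheory.Automorphic.Sweep1SymmetricPower`, on the way to the discharge of its
named fact `Literature.NumberTheory.Automorphic.Gelbart1975_exists_isAutomorphicRepOf`
(Gelbart (1975), Thm. 5.19 (a) with Lemma 5.16, (5.17)–(5.18); Bump (1997), Thm. 3.6.1): *a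
newform `f ∈ S_k(Γ₁(N))`, `k ≥ 2`, has a cuspidal automorphic representation `π_f` of
`GL₂(𝔸_ℚ)` — an irreducible closed subrepresentation of `L²_cusp(GL₂(𝔸_ℚ) ⧸ A_G GL₂(ℚ), μ)` for
an automorphic measure `μ` — whose Satake pair at almost every `p` is the unitary Satake pair
`{α, β}` of `f`, `α + β = a_p p^{-(k-1)/2}`, `αβ = χ_f(p)`*.

`Sweep1SymmetricPowerAdelicProofs` proved the fact from the two trunk statements it rests on
(`Gelbart1975_exists_isAutomorphicRepOf_of_isDiscretelyDecomposable`), Gelbart's own content —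
the adelisation `φ_f` of `f`, its cuspidality (Prop. 3.1 (vii)) and its Hecke eigenvalues
(Lemma 3.7), and the projection of `φ_f` to an irreducible constituent keeping the Hecke
eigenvalues (proof of Thm. 5.19, p. 62; Bump, pp. 340–342) — being theorems of the tree:

1. existence of an automorphic measure on `GL₂(𝔸_ℚ) ⧸ A_G GL₂(ℚ)`
   (`AdelicGroupData.exists_isAutomorphicMeasure_gl 2 ℚ`; Borel (1963), Thm. 5.8: finite
   invariant volume of `G_A / G_k A`), a named fact of `AdelicGroupData`;
2. discrete decomposability of `L²_cusp(GL₂(𝔸_ℚ) ⧸ A_G GL₂(ℚ), μ)` for automorphic `μ`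
   (`AutomorphicGLn.isDiscretelyDecomposable_cuspidal 2 ℚ μ`; Gelfand–Graev–Piatetski-Shapiro
   (1969), Ch. 3; Gelbart, Thm. 5.1 with Lemma 5.2).

Input 2 is now a theorem of the tree for every `GL_n` over every number field
(`AutomorphicGLn.isDiscretelyDecomposable_cuspidal_holds` of `GLnCuspidalSpectrumDiscreteProofs`:
the basic estimate on Siegel sets, reduction theory, Dirac sequences of test functions and the
compact-operator decomposition lemma, all proved). This file feeds it in:

* `exists_isAutomorphicRepOf_of_isNewform1` — **unconditionally, for every automorphic measure
  `μ` on `GL₂(𝔸_ℚ) ⧸ A_G GL₂(ℚ)`, every newform of weight `k ≥ 2` has a cuspidal automorphic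
  representation `P ≤ L²_cusp(μ)` with `IsAutomorphicRepOf f P`** (Gelbart, Thm. 5.19 (a) for the
  space `L²(G_ℚ \ G_𝔸)` built on `μ`);
* `Gelbart1975_exists_isAutomorphicRepOf_of_exists_isAutomorphicMeasure` — the named fact (which
  also asserts the existence of an automorphic `μ`) follows from input 1 alone;
* `exists_cuspidal_symmetricPower_of_exists_isAutomorphicMeasure`,
  `exists_cuspidal_symmetricPower_iff_newtonThorne2021_of_exists_isAutomorphicMeasure` — lang.S24
  (`exists_cuspidal_symmetricPower`) from input 1 and Newton–Thorne's Thm. A in weak-lift form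
  (`NewtonThorne2021_exists_cuspidal_symmPowerLift`), to which it is then equivalent.

The discharge `Gelbart1975_exists_isAutomorphicRepOf_holds` is therefore exactly
`Gelbart1975_exists_isAutomorphicRepOf_of_exists_isAutomorphicMeasure h` for a proof `h` of
Borel–Harish-Chandra finiteness `AdelicGroupData.exists_isAutomorphicMeasure_gl 2 ℚ`, whose
proof (finite Haar volume of a Siegel set of `GL₂(𝔸_ℚ)`, Borel (1963), Thm. 5.8) is in progress
elsewhere in this directory (`AdelicGroupDataCompactMeasure`, `AdelicGroupDataGLOneMeasureProofs`
for the compact case `n = 1`; `SiegelConeDyadic`, `SiegelVolumeDecay`, `UnipotentAdelicHaar`,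
`BorelCompactPartGL` for the volume computation).

## References

* S. Gelbart, *Automorphic forms on adele groups*, Ann. of Math. Stud. 83 (1975): §5.A,
  Thm. 5.1, Lemma 5.2 (PDF pp. 53–54); §5.C, Lemma 5.16, (5.17)–(5.18), Thm. 5.19, p. 62
  [Gelbart1975].
* D. Bump, *Automorphic forms and representations* (1997), Thm. 3.6.1 and its proof,
  pp. 338–342 [Bump1997].
* A. Borel, *Some finiteness properties of adele groups over number fields*, Publ. Math. IHÉS 16
  (1963), Thm. 5.8 [Borel1963].
* I. M. Gelfand, M. I. Graev, I. I. Piatetski-Shapiro, *Representation theory and automorphic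
  functions* (1969), Ch. 3 [GelfandGraevPiatetskiShapiro1969].
* J. Newton, J. A. Thorne, *Symmetric power functoriality for holomorphic modular forms, II*,
  Publ. Math. IHÉS 134 (2021), Thm. A [NewtonThorneIHES2021b].
-/

noncomputable section

open NumberField IsDedekindDomain MeasureTheory

namespace Literature.NumberTheory.Automorphic

open EllipticCurves.ModularForms

variable {N : ℕ} [NeZero N] {k : ℤ}

/-- **Every newform of weight `≥ 2` has a cuspidal automorphic representation, for every
automorphic measure** (Gelbart (1975), Thm. 5.19 (a), p. 62; Bump (1997), Thm. 3.6.1, proof,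
pp. 340–342), unconditionally: for every automorphic measure `μ` on `GL₂(𝔸_ℚ) ⧸ A_G GL₂(ℚ)` and
every newform `f ∈ S_k(Γ₁(N))`, `k ≥ 2` (`IsNewform1`), there is a cuspidal automorphic
representation `P ≤ L²_cusp(GL₂(𝔸_ℚ) ⧸ A_G GL₂(ℚ), μ)` (`CuspidalAutomorphicRepGL`) which is the
automorphic representation of `f` (`IsAutomorphicRepOf`: at the level `K(N)` and almost every
`p`, `P` has the unitary Satake pair of `f`). Proof:
`exists_isAutomorphicRepOf_of_isDiscretelyDecomposable` (`Sweep1SymmetricPowerAdelicProofs`: the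
adelisation of `f`, its cuspidality and Hecke eigenvalues, and the projection to an irreducible
constituent, all proved) fed with the discrete decomposability of `L²_cusp(μ)`, now the theorem
`AutomorphicGLn.isDiscretelyDecomposable_cuspidal_holds 2 ℚ μ` (`GLnCuspidalSpectrumDiscreteProofs`;
Gelfand–Graev–Piatetski-Shapiro). [cite: Gelbart1975, Thm. 5.19 (a) and Lemma 5.16, (5.18)]
[cite: Bump1997, Thm. 3.6.1 (proof, pp. 340–342)] -/
theorem exists_isAutomorphicRepOf_of_isNewform1
    (μ : Measure (AdelicGroupData.gl 2 ℚ).automorphicQuotient)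
    [(AdelicGroupData.gl 2 ℚ).IsAutomorphicMeasure μ]
    (hk : 2 ≤ k) {f : CuspForm (CongruenceSubgroup.Gamma1 N) k} (hf : IsNewform1 f) :
    ∃ P : CuspidalAutomorphicRepGL 2 ℚ μ, IsAutomorphicRepOf f P.1 :=
  exists_isAutomorphicRepOf_of_isDiscretelyDecomposable μ
    (AutomorphicGLn.isDiscretelyDecomposable_cuspidal_holds 2 ℚ μ) hk hf

/-- **Gelbart's dictionary from Borel–Harish-Chandra finiteness alone** (Gelbart (1975),
Thm. 5.19 (a) in the vendored form `Gelbart1975_exists_isAutomorphicRepOf`; Bump (1997),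
Thm. 3.6.1): the existence of an automorphic measure on `GL₂(𝔸_ℚ) ⧸ A_G GL₂(ℚ)`
(`AdelicGroupData.exists_isAutomorphicMeasure_gl 2 ℚ`; Borel (1963), Thm. 5.8) implies the named
fact — `Gelbart1975_exists_isAutomorphicRepOf_of_isDiscretelyDecomposable` with its second input,
discrete decomposability of `L²_cusp`, supplied by the theorem
`AutomorphicGLn.isDiscretelyDecomposable_cuspidal_holds`. The discharge
`Gelbart1975_exists_isAutomorphicRepOf_holds` is this theorem applied to a proof of
`exists_isAutomorphicMeasure_gl 2 ℚ`. [cite: Gelbart1975, Thm. 5.19 (a)]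
[cite: Borel1963, Thm. 5.8] -/
theorem Gelbart1975_exists_isAutomorphicRepOf_of_exists_isAutomorphicMeasure
    (hμ : AdelicGroupData.exists_isAutomorphicMeasure_gl 2 ℚ) :
    Gelbart1975_exists_isAutomorphicRepOf (N := N) (k := k) :=
  Gelbart1975_exists_isAutomorphicRepOf_of_isDiscretelyDecomposable hμ
    fun μ _ => AutomorphicGLn.isDiscretelyDecomposable_cuspidal_holds 2 ℚ μ

/-- **lang.S24 from Borel–Harish-Chandra finiteness and Newton–Thorne's Thm. A**: the existence
of an automorphic measure on `GL₂(𝔸_ℚ) ⧸ A_G GL₂(ℚ)` (`exists_isAutomorphicMeasure_gl 2 ℚ`) and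
the weak-lift form of Newton–Thorne's theorem (`NewtonThorne2021_exists_cuspidal_symmPowerLift`)
imply `exists_cuspidal_symmetricPower` (`exists_cuspidal_symmetricPower_of_newtonThorne2021` of
`Sweep1SymmetricPowerAdelicProofs`, discrete decomposability of `L²_cusp` being the theorem
`AutomorphicGLn.isDiscretelyDecomposable_cuspidal_holds`). [cite: NewtonThorneIHES2021b, Thm. A] -/
theorem exists_cuspidal_symmetricPower_of_exists_isAutomorphicMeasure
    (hμ : AdelicGroupData.exists_isAutomorphicMeasure_gl 2 ℚ)
    (hNT : NewtonThorne2021_exists_cuspidal_symmPowerLift (N := N) (k := k)) :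
    exists_cuspidal_symmetricPower (N := N) (k := k) :=
  exists_cuspidal_symmetricPower_of_newtonThorne2021 hμ
    (fun μ _ => AutomorphicGLn.isDiscretelyDecomposable_cuspidal_holds 2 ℚ μ) hNT

/-- **Granted Borel–Harish-Chandra finiteness, lang.S24 is equivalent to the weak-lift form of
Newton–Thorne's Thm. A** (`exists_cuspidal_symmetricPower_iff_newtonThorne2021_of_isDiscretelyDecomposable`
of `Sweep1SymmetricPowerAdelicProofs`, discrete decomposability of `L²_cusp` being the theorem
`AutomorphicGLn.isDiscretelyDecomposable_cuspidal_holds`). [cite: NewtonThorneIHES2021b, Thm. A] -/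
theorem exists_cuspidal_symmetricPower_iff_newtonThorne2021_of_exists_isAutomorphicMeasure
    (hμ : AdelicGroupData.exists_isAutomorphicMeasure_gl 2 ℚ) :
    exists_cuspidal_symmetricPower (N := N) (k := k) ↔
      NewtonThorne2021_exists_cuspidal_symmPowerLift (N := N) (k := k) :=
  exists_cuspidal_symmetricPower_iff_newtonThorne2021_of_isDiscretelyDecomposable hμ
    fun μ _ => AutomorphicGLn.isDiscretelyDecomposable_cuspidal_holds 2 ℚ μ

end Literature.NumberTheory.Automorphic
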